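import Summits.BirchSwinnertonDyer.BirchSwinnertonDyer.Theorems.PrintCFramBottomClassIndexLawFiveLeBernoulliKummerDictionaryClass
import Summits.BirchSwinnertonDyer.BirchSwinnertonDyer.Theorems.PrintCFramBottomClassIndexLawFiveLeKrizLiBindersKroneckerField
import Summits.BirchSwinnertonDyer.Rank1Residual.X12.CMNoPrimeTorsion
import Summits.BirchSwinnertonDyer.Rank1Residual.X12.CMRamifiedAdditive
import Literature.NumberTheory.EllipticCurves.Hsieh2014.AnticyclotomicPAdicLFunctionRamifiedSteinbergCorollaries
import Literature.NumberTheory.EllipticCurves.ModularityVersionApProofs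
import HarnessLib

/-!
# Crux `PrintCFram.BottomClassIndexLawFiveLe` (stmt-BirchSwinnertonDyer-20372), line `eisenstein-resource-bdp-line` (registry v19):
# THE SEED OF STUB C — at the CM field `K₀ = ℚ(√−p)` itself the FIELD factor of Stub C IS the CLASS factor
# (cell `bsd-print-cfram`, width seat `bsd-line-cfram-p1-w8` g5; THEOREMS ONLY, `--supports` 20372; BSD is not proved by any of this)

HONEST FRAMING. Nothing here is a statement about BSD and no stub is closed. Registry v19's Stub C
(`stub_heegnerField_of_unitClassFactor`) asks, for a class member `W` (CM, `p ≥ 5` CM-ramified, `r_an = 1`) with odd datum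
`(f, ψ, ω)` and UNIT class factor `‖B_{1,ψ⁻¹~}‖_p = 1`, for an imaginary quadratic `K''` HEEGNER for `N_W` (odd `d < −4`) with a
Kronecker character `ε_{K''}` and UNIT field factor `‖B_{1,(ψ ε_{K''} ω⁻¹)~}‖_p = 1`. This file proves that the ONE imaginary
quadratic field the Heegner hypothesis can never admit — the CM field `K₀ = ℚ(√−p)` of the class (`p ∣ N_W` is additive and
`p` ramifies in `K₀`) — passes every OTHER clause of Stub C exactly when the class factor is a unit, because its field factor is
LITERALLY the class factor:

  `bernoulliOnePrim (bernoulliCharTwo ψ ε_{K₀} ω) = bernoulliOnePrim ψ⁻¹`   (`bernoulliOnePrim_bernoulliCharTwo_cmField_eq`).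

MECHANISM (values of characters, no Bernoulli congruence). On the class data `(m, χ, k)` of
`KrizLiBinders.exists_krizLiData_of_cmRamified` one has `ψ(ℓ) = χ(ℓ)ω(ℓ)^k` with `k ∈ {(p+1)/4, (3p−1)/4}`
(`KummerDictionary.exists_classData_apply_eq_of_hss`), hence `ψ⁻¹(ℓ) = χ(ℓ)ω(ℓ)^{p−1−k}`; the Kronecker character of a quadratic
field of discriminant `−p` (`p ≡ 3 (mod 4)`) is the Legendre symbol `(·/p)`, which in `ℚ_p` is `ω^{(p−1)/2}` (Euler's criterion
read on the Teichmüller lift, §1–§2); and `(p−1)/2 + (k−1) ≡ p−1−k (mod p−1)` PRECISELY for these two values of `k` (§3: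
`2k − 1 + (p−1)/2 ∈ {p−1, 2(p−1)}`), so `(ψ ε_{K₀} ω⁻¹)(ℓ) = χ(ℓ)ω(ℓ)^{(p−1)/2+k−1} = ψ⁻¹(ℓ)` at almost all primes and the two
primitive characters — hence the two Bernoulli numbers — coincide (w8 g3's `bernoulliOnePrim_eq_generalizedBernoulli_thetaShape`).
In Galois terms: `W[p]^{ss} = ψ ⊕ ψ⁻¹ω` with `ψ⁻¹ω = ψ·ε_{K₀}` because `W` has CM by `K₀` (`ψ² = ω ε_{K₀}`).

WHY IT MATTERS FOR THE ANALYTIC ITEM (w8 g4's curve-free `(P)` / `(P_fam)`, `…HeegnerFieldSupplySocket`, `…HeegnerFamilySupply`).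
In Cohen–Eisenstein currency (`…BernoulliKummerDictionary`: class factor `≡ B_{p−k,χ_e}/(p−k) = −H(p−k, |e|)`, field factor at
`K''` `≡ B_{k,χ_eε_{K''}}/k = −H(k, |e·d_{K''}|)`), the identity says that the field factor at the inadmissible `d = −p` is the class
factor; with the Kummer congruence on the ramified branch (the companion Literature file of this seat) it reads
`H(k, p·N) ≡ H(p−k, N) (mod p)` for all `N` prime to `p`, i.e. `H_k | U_p ≡ H_{p−k} (mod p)` for `k + k' = p`,
`k ∈ {(p+1)/4, (3p−1)/4}` — the unit class factor is ONE EXPLICIT coefficient, at index `p·|e|`, of the weight-`k+1/2`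
Cohen–Eisenstein series that a mod-`p` non-vanishing argument for `(P)` has to start from (the «seed»; crux notes
`Lines/eisenstein-resource-bdp-line-w8g5-notes.md`). beyond-print theorem: NO.

CONTENTS. §1 `ω(ℓ)^{(p−1)/2} = (ℓ/p)` in `ℚ_p` for a Teichmüller `ω`. §2 the Kronecker character of an imaginary quadratic field of
discriminant `−p` takes the values `ω(ℓ)^{(p−1)/2}` at primes `ℓ ≠ p`. §3 the exponent identity for `k ∈ {(p+1)/4, (3p−1)/4}`.
§4 on the crux's binders: the Bernoulli identity, the `‖·‖ ≤ p⁻¹` equivalence (B1's premise ⟺ «the field factor at `K₀` is a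
non-unit»), and the inadmissibility of `K₀` (`p ∣ N_W` does not split in `K₀`), so that Stub C's witness is never `K₀` itself.

References: [KrizLi2019] Thm. 1.20, §8; [Washington1997] §5.1, Thm. 5.11; [Cox2013] §1.C Lemma 1.14; [IrelandRosen1990] Prop. 5.1.2
(Euler's criterion); registry v19 `Cruxes/BottomClassIndexLawFiveLe/Lines/eisenstein_resource_bdp_line.lean`.
-/

set_option autoImplicit false
-- summit-side namespace `Summit.BirchSwinnertonDyer.BirchSwinnertonDyer.…` (single-conjunct summit, D-0017 layout)
set_option linter.dupNamespace false

noncomputable section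

open scoped Classical NumberTheorySymbols
open NumberField WeierstrassCurve DirichletCharacter Literature.NumberTheory.LFunctions
  Literature.NumberTheory.EllipticCurves Literature.NumberTheory.EllipticCurves.KrizLi2019
  Literature.NumberTheory.EllipticCurves.Rank1Residual

namespace Summit.BirchSwinnertonDyer.BirchSwinnertonDyer.Theorems.PrintCFram.HeegnerFieldSupply

open Summit.BirchSwinnertonDyer.BirchSwinnertonDyer.Theorems.PrintCFram
open Summit.BirchSwinnertonDyer.BirchSwinnertonDyer.Theorems.PrintCFram.KummerDictionary
open Summit.BirchSwinnertonDyer.Rank1Residual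

variable {p : ℕ} [hp : Fact p.Prime]

/-! ## §1 Euler's criterion on the Teichmüller lift: `ω(ℓ)^{(p−1)/2} = (ℓ/p)` in `ℚ_p` -/

/-- A rational integer divisible by `p` has `p`-adic norm `< 1` (cast to `ℚ_p`). [folklore] -/
private theorem norm_intCast_lt_one_of_dvd {z : ℤ} (hz : (p : ℤ) ∣ z) : ‖(z : ℚ_[p])‖ < 1 :=
  Padic.norm_intCast_lt_one_iff.mpr hz

/-- **Euler's criterion read on the Teichmüller character: `ω(ℓ)^{(p−1)/2} = (ℓ/p)` in `ℚ_p`** for `p` odd, `ω` Teichmüller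
(`ω(a) ≡ a (mod p)`) and `p ∤ ℓ`. Both sides are `±1` (`ω(ℓ)^{p−1} = 1`, `KrizLi2019.apply_pow_sub_one_eq_one`) and they are
congruent modulo `p` (`ω(ℓ)^{(p−1)/2} ≡ ℓ^{(p−1)/2} ≡ (ℓ/p)`, Mathlib `legendreSym.eq_pow`), while `‖2‖_p = 1`.
[cite: IrelandRosen1990, Prop. 5.1.2 (Euler's criterion)] [cite: Washington1997, §5.1 (the Teichmüller character)] -/
theorem teichmuller_pow_half_eq_legendreSym {ω : DirichletCharacter ℚ_[p] p} (hω : IsTeichmullerCharacter ω)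
    (hp2 : p ≠ 2) {ℓ : ℕ} (hℓ : ¬ p ∣ ℓ) :
    ω (ℓ : ZMod p) ^ ((p - 1) / 2) = (legendreSym p ℓ : ℚ_[p]) := by
  have hpp := hp.out
  have hodd : p % 2 = 1 := by rcases hpp.eq_two_or_odd with h | h <;> omega
  set h := (p - 1) / 2 with hh
  have h2h : h * 2 = p - 1 := by omega
  have hdiv : p / 2 = h := by omega
  have hℓZ : ¬ ((p : ℤ) ∣ (ℓ : ℤ)) := by rwa [Int.natCast_dvd_natCast]
  -- `y := ω(ℓ)^h` squares to `1`
  set x : ℚ_[p] := ω (ℓ : ZMod p) with hx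
  have hx1 : x ^ (p - 1) = 1 := by
    have h1 := apply_pow_sub_one_eq_one ω (ℓ : ℤ) hℓZ
    rwa [Int.cast_natCast] at h1
  have hy2 : x ^ h * x ^ h = 1 := by rw [← pow_two, ← pow_mul, h2h, hx1]
  have hy : x ^ h = 1 ∨ x ^ h = -1 := mul_self_eq_one_iff.mp hy2
  -- `‖ω(ℓ)^h − ℓ^h‖ < 1`
  have hxℓ : ‖x ^ h - ((ℓ : ℚ_[p])) ^ h‖ < 1 := by
    set X : ℤ_[p] := ⟨x, Literature.NumberTheory.Congruences.CharacterTwist.norm_apply_le_one ω _⟩ with hX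
    have hXℓ : (p : ℤ_[p]) ∣ X - (ℓ : ℤ_[p]) := by
      rw [← PadicInt.norm_lt_one_iff_dvd, PadicInt.norm_def, PadicInt.coe_sub]
      have h1 := hω ℓ hℓZ
      simpa [hX, Int.cast_natCast] using h1
    have hd : (p : ℤ_[p]) ∣ X ^ h - (ℓ : ℤ_[p]) ^ h := dvd_trans hXℓ (sub_dvd_pow_sub_pow _ _ _)
    have hn : ‖X ^ h - (ℓ : ℤ_[p]) ^ h‖ < 1 := (PadicInt.norm_lt_one_iff_dvd _).mpr hd
    rw [PadicInt.norm_def, PadicInt.coe_sub, PadicInt.coe_pow, PadicInt.coe_pow] at hn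
    simpa [hX] using hn
  -- `‖(ℓ/p) − ℓ^h‖ < 1` (Euler)
  have hLℓ : ‖(legendreSym p ℓ : ℚ_[p]) - ((ℓ : ℚ_[p])) ^ h‖ < 1 := by
    have hE : ((legendreSym p ℓ - (ℓ : ℤ) ^ h : ℤ) : ZMod p) = 0 := by
      push_cast
      rw [legendreSym.eq_pow, hdiv, Int.cast_natCast, sub_self]
    have hdvd : (p : ℤ) ∣ legendreSym p ℓ - (ℓ : ℤ) ^ h := (ZMod.intCast_zmod_eq_zero_iff_dvd _ p).mp hE
    have hn := norm_intCast_lt_one_of_dvd (p := p) hdvd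
    push_cast at hn
    exact hn
  -- hence `‖ω(ℓ)^h − (ℓ/p)‖ < 1`
  have hyL : ‖x ^ h - (legendreSym p ℓ : ℚ_[p])‖ < 1 := by
    have e : x ^ h - (legendreSym p ℓ : ℚ_[p]) =
        (x ^ h - ((ℓ : ℚ_[p])) ^ h) + -((legendreSym p ℓ : ℚ_[p]) - ((ℓ : ℚ_[p])) ^ h) := by ring
    rw [e]
    refine (IsUltrametricDist.norm_add_le_max _ _).trans_lt (max_lt hxℓ ?_)
    rwa [norm_neg]
  -- both are `±1` and `‖2‖_p = 1`
  have hℓ0 : ((ℓ : ℤ) : ZMod p) ≠ 0 := by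
    rw [Int.cast_natCast, Ne, ZMod.natCast_eq_zero_iff]
    exact hℓ
  have h2 : ‖(2 : ℚ_[p])‖ = 1 := by
    have hle : ‖((2 : ℤ) : ℚ_[p])‖ ≤ 1 := Padic.norm_int_le_one 2
    have hnlt : ¬ ‖((2 : ℤ) : ℚ_[p])‖ < 1 := by
      rw [Padic.norm_intCast_lt_one_iff]
      intro hd
      have := Int.le_of_dvd (by norm_num) hd
      have h2' : (p : ℤ) = 2 ∨ (p : ℤ) = 1 := by
        have hp1 : (1 : ℤ) < p := by exact_mod_cast hpp.one_lt
        omega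
      rcases h2' with h2' | h2'
      · exact hp2 (by exact_mod_cast h2')
      · exact hpp.ne_one (by exact_mod_cast h2')
    have : ‖((2 : ℤ) : ℚ_[p])‖ = 1 := le_antisymm hle (not_lt.mp hnlt)
    simpa using this
  rcases hy with hy | hy <;> rcases legendreSym.eq_one_or_neg_one p hℓ0 with hL | hL <;>
    rw [hy, hL] at hyL ⊢ <;> push_cast at hyL ⊢ <;> try rfl
  · exfalso
    have : ‖(1 : ℚ_[p]) - -1‖ = 1 := by rw [sub_neg_eq_add, one_add_one_eq_two, h2]
    linarith
  · exfalso
    have : ‖(-1 : ℚ_[p]) - 1‖ = 1 := by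
      rw [show (-1 : ℚ_[p]) - 1 = -2 by ring, norm_neg, h2]
    linarith

/-! ## §2 The Kronecker character of `ℚ(√−p)` is `ω^{(p−1)/2}` at the primes `ℓ ≠ p` -/

/-- **The Kronecker character of an imaginary quadratic field of discriminant `−p` takes the value `ω(ℓ)^{(p−1)/2}` at every
prime `ℓ ≠ p`** (`p ≡ 3 (mod 4)`, `ω` Teichmüller): `ε_{K₀}(ℓ) = ±1` by the splitting of `ℓ` (`IsKroneckerCharacterOf`), the
splitting is read by `J(ℓ | p)` (`KrizLiBinders.kroneckerValue_of_discr_eq_neg`), and `J(ℓ | p) = (ℓ/p) = ω(ℓ)^{(p−1)/2}` (§1).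
[cite: Cox2013, §1.C Lemma 1.14 and (1.18)] [cite: KrizLi2019, §2 (p. 12, ε_K)] -/
theorem kroneckerCharacter_apply_eq_teichmuller_pow (hp3 : p % 4 = 3) {K₀ : Type} [Field K₀] [NumberField K₀]
    (hK₀ : IsImaginaryQuadratic K₀) (hd : NumberField.discr K₀ = -(p : ℤ))
    {ε₀ : DirichletCharacter ℚ_[p] (NumberField.discr K₀).natAbs} (hε₀ : IsKroneckerCharacterOf K₀ ε₀)
    {ω : DirichletCharacter ℚ_[p] p} (hω : IsTeichmullerCharacter ω) {ℓ : ℕ} (hℓ : ℓ.Prime) (hℓp : ℓ ≠ p) :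
    ε₀ (ℓ : ZMod (NumberField.discr K₀).natAbs) = ω (ℓ : ZMod p) ^ ((p - 1) / 2) := by
  haveI : NeZero p := ⟨hp.out.ne_zero⟩
  obtain ⟨κ, hκ⟩ := KrizLiBinders.exists_jacobiCharPadic (p := p) p
  have hnd : ¬ ((ℓ : ℤ) ∣ NumberField.discr K₀) := by
    rw [hd, dvd_neg, Int.natCast_dvd_natCast, Nat.prime_dvd_prime_iff_eq hℓ hp.out]
    exact hℓp
  have hℓnp : ¬ p ∣ ℓ := fun h ↦ hℓp ((Nat.prime_dvd_prime_iff_eq hp.out hℓ).mp h).symm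
  rw [hε₀.2 ℓ hℓ hnd, ← KrizLiBinders.kroneckerValue_of_discr_eq_neg hK₀.1 hp3 hd κ hκ ℓ hℓ hnd, hκ ℓ,
    ← jacobiSym.legendreSym.to_jacobiSym, teichmuller_pow_half_eq_legendreSym hω (by omega) hℓnp]

/-! ## §3 The exponent identity of the class exponents `k ∈ {(p+1)/4, (3p−1)/4}` -/

omit hp in
/-- **`(p−1)/2 + (k−1) = p−1−k` or `= (p−1−k) + (p−1)`** for `p ≡ 3 (mod 4)` and `k = (p+1)/4`, resp. `k = (3p−1)/4` — i.e.
`2k − 1 + (p−1)/2 ≡ 0 (mod p−1)`: the characters `χω^{k−1}·(·/p)` and `χω^{−k}` coincide. [folklore] -/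
theorem half_add_classExponent_pred (hp3 : p % 4 = 3) {k : ℕ} (hk : k = (p + 1) / 4 ∨ k = (3 * p - 1) / 4) :
    (p - 1) / 2 + (k - 1) = p - 1 - k ∨ (p - 1) / 2 + (k - 1) = (p - 1 - k) + (p - 1) := by
  omega

/-- **`ω(ℓ)^{(p−1)/2}·ω(ℓ)^{k−1} = ω(ℓ)^{p−1−k}`** at `p ∤ ℓ`, for `p ≡ 3 (mod 4)` and `k ∈ {(p+1)/4, (3p−1)/4}`
(§3 and `ω(ℓ)^{p−1} = 1`). [cite: Washington1997, §5.1 (ω(a)^{p−1} = 1)] -/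
theorem teichmuller_pow_half_mul_pow_eq (hp3 : p % 4 = 3) {k : ℕ} (hk : k = (p + 1) / 4 ∨ k = (3 * p - 1) / 4)
    (ω : DirichletCharacter ℚ_[p] p) {ℓ : ℕ} (hℓ : ¬ p ∣ ℓ) :
    ω (ℓ : ZMod p) ^ ((p - 1) / 2) * ω (ℓ : ZMod p) ^ (k - 1) = ω (ℓ : ZMod p) ^ (p - 1 - k) := by
  have hℓZ : ¬ ((p : ℤ) ∣ (ℓ : ℤ)) := by rwa [Int.natCast_dvd_natCast]
  have hω1 : ω (ℓ : ZMod p) ^ (p - 1) = 1 := by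
    have h1 := apply_pow_sub_one_eq_one ω (ℓ : ℤ) hℓZ
    rwa [Int.cast_natCast] at h1
  rw [← pow_add]
  rcases half_add_classExponent_pred hp3 hk with h | h
  · rw [h]
  · rw [h, pow_add, hω1, mul_one]

/-! ## §4 On the crux's binders: the field factor at the CM field is the class factor -/

section Binders

variable (W : WeierstrassCurve ℚ) [W.IsElliptic]

/-- `p ≡ 3 (mod 4)` for a CM-ramified `p ≥ 5` (`p ∈ {7, 11, 19, 43, 67, 163}`, `X12.eq_of_dvd_cmFieldDiscrOfJ`).
[cite: SilvermanATAEC1994, App. A §3 (table of CM j-invariants)] -/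
theorem mod_four_eq_three_of_cmRamified (hCM : W.HasCM) (hram : CMRamified W p) (h5 : 5 ≤ p) : p % 4 = 3 := by
  rcases (X12.eq_of_dvd_cmFieldDiscrOfJ W hCM hp.out h5 hram).1 with h | h | h | h | h | h <;> subst h <;> norm_num

/-- **The CM field's discriminant is `−p`** on the class: `cmFieldDiscrOfJ (j W) = −p` (`X12.eq_of_dvd_cmFieldDiscrOfJ`), recorded
in the shape used below. [cite: SilvermanATAEC1994, App. A §3 (table of CM j-invariants)] -/
theorem cmFieldDiscrOfJ_eq_neg_of_cmRamified (hCM : W.HasCM) (hram : CMRamified W p) (h5 : 5 ≤ p) :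
    cmFieldDiscrOfJ W.j = -(p : ℤ) :=
  (X12.eq_of_dvd_cmFieldDiscrOfJ W hCM hp.out h5 hram).2

/-- **THE SEED IDENTITY: `B_{1,(ψ ε_{K₀} ω⁻¹)~} = B_{1,ψ⁻¹~}` — the field factor of Stub C at the CM field `K₀` (`d_{K₀} = −p`)
IS the class factor.** For `W/ℚ` elliptic with CM, `p ≥ 5` CM-ramified, `ω` Teichmüller, ANY odd `(f, ψ)` with the trace
congruence `hss`, ANY imaginary quadratic `K₀` with `d_{K₀} = −p` and any Kronecker character `ε₀` of `K₀`:
`bernoulliOnePrim (bernoulliCharTwo ψ ε₀ ω) = bernoulliOnePrim ψ⁻¹`. Both are `B_{1,Θ}` for the primitive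
`Θ = χ↑·(ω^{p−1−k})↑` of the class data (values at almost all primes, §2–§3).
[cite: KrizLi2019, Thm. 1.20 (p. 8, the two Bernoulli numbers) and §8] [cite: Washington1997, §5.1] -/
theorem bernoulliOnePrim_bernoulliCharTwo_cmField_eq (hCM : W.HasCM) (hram : CMRamified W p) (h5 : 5 ≤ p)
    (ω : DirichletCharacter ℚ_[p] p) (hω : IsTeichmullerCharacter ω)
    {f : ℕ} [hf : NeZero f] (ψ : DirichletCharacter ℚ_[p] f) (hψ : ψ.Odd)
    (hss : ∀ ℓ : ℕ, ℓ.Prime → ¬ (ℓ ∣ p * W.conductorNorm ℤ) →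
      ‖((W.LFunction ℓ : ℤ) : ℚ_[p]) - (ψ (ℓ : ZMod f) + ψ⁻¹ (ℓ : ZMod f) * ω (ℓ : ZMod p))‖ < 1)
    {K₀ : Type} [Field K₀] [NumberField K₀] (hK₀ : IsImaginaryQuadratic K₀) (hd : NumberField.discr K₀ = -(p : ℤ))
    (ε₀ : DirichletCharacter ℚ_[p] (NumberField.discr K₀).natAbs) (hε₀ : IsKroneckerCharacterOf K₀ ε₀) :
    bernoulliOnePrim (bernoulliCharTwo ψ ε₀ ω) = bernoulliOnePrim ψ⁻¹ := by
  have hpp := hp.out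
  have hp3 := mod_four_eq_three_of_cmRamified W hCM hram h5
  have hdn : (NumberField.discr K₀).natAbs = p := by rw [hd]; simp
  haveI hd0 : NeZero (NumberField.discr K₀).natAbs := ⟨by rw [hdn]; exact hpp.ne_zero⟩
  obtain ⟨m, hm, χ, ε, k, hmp, hχ, hχq, -, hk, hk2, hkp, -, -, hval⟩ :=
    exists_classData_apply_eq_of_hss W hCM hram h5 ω hω ψ hψ hss
  haveI := hm
  have hne : ¬ ψ.Even := EisensteinPair.not_even_of_odd' ψ hψ
  have hN₀ : p * m * f * p ≠ 0 :=
    Nat.mul_ne_zero (Nat.mul_ne_zero (Nat.mul_ne_zero hpp.ne_zero hm.out) hf.out) hpp.ne_zero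
  -- values of `ψ⁻¹`
  have hinv : ∀ ℓ : ℕ, ℓ.Prime → ¬ ℓ ∣ p * m * f * p →
      ψ⁻¹ (ℓ : ZMod f) = χ (ℓ : ZMod m) * ω (ℓ : ZMod p) ^ (p - 1 - k) := fun ℓ hℓ hℓN ↦ by
    have hcop : ℓ.Coprime (p * m * f * p) := (Nat.Prime.coprime_iff_not_dvd hℓ).mpr hℓN
    have hℓp0 : ℓ.Coprime p := Nat.Coprime.coprime_mul_left_right hcop
    have hℓp : ¬ p ∣ ℓ := fun h' ↦ hpp.ne_one (Nat.Coprime.eq_one_of_dvd (Nat.coprime_comm.mp hℓp0) h')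
    have h := inv_apply_eq_of_apply_eq ψ χ ω (by omega) hℓp (hval ℓ hcop)
    rwa [hχq.inv] at h
  -- values of `ψ ε₀ ω⁻¹`
  have htwo : ∀ ℓ : ℕ, ℓ.Prime → ¬ ℓ ∣ p * m * f * p →
      bernoulliCharTwo ψ ε₀ ω (ℓ : ZMod (f * (NumberField.discr K₀).natAbs * p)) =
        χ (ℓ : ZMod m) * ω (ℓ : ZMod p) ^ (p - 1 - k) := fun ℓ hℓ hℓN ↦ by
    have hcop : ℓ.Coprime (p * m * f * p) := (Nat.Prime.coprime_iff_not_dvd hℓ).mpr hℓN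
    have hℓp0 : ℓ.Coprime p := Nat.Coprime.coprime_mul_left_right hcop
    have hℓp : ¬ p ∣ ℓ := fun h' ↦ hpp.ne_one (Nat.Coprime.eq_one_of_dvd (Nat.coprime_comm.mp hℓp0) h')
    have hℓnp : ℓ ≠ p := fun h' ↦ hℓp (h' ▸ dvd_rfl)
    have hℓf : ℓ.Coprime f :=
      Nat.Coprime.coprime_dvd_right (dvd_mul_of_dvd_left (dvd_mul_left f (p * m)) p) hcop
    have hℓd : ℓ.Coprime (NumberField.discr K₀).natAbs := by rw [hdn]; exact hℓp0
    have hfdp : ℓ.Coprime (f * (NumberField.discr K₀).natAbs * p) :=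
      Nat.Coprime.mul_right (Nat.Coprime.mul_right hℓf hℓd) hℓp0
    rw [bernoulliCharTwo_apply_eq_of_apply_eq ψ χ ε₀ ω hne (by omega) hfdp (hval ℓ hcop),
      kroneckerCharacter_apply_eq_teichmuller_pow hp3 hK₀ hd hε₀ hω hℓ hℓnp, mul_assoc,
      teichmuller_pow_half_mul_pow_eq hp3 hk ω hℓp]
  rw [bernoulliOnePrim_eq_generalizedBernoulli_thetaShape hmp χ hχ hω (j := p - 1 - k) (by omega) (by omega)
      (bernoulliCharTwo ψ ε₀ ω) hN₀ htwo,
    bernoulliOnePrim_eq_generalizedBernoulli_thetaShape hmp χ hχ hω (j := p - 1 - k) (by omega) (by omega)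
      ψ⁻¹ hN₀ hinv]

/-- **B1's premise ⟺ «the field factor at the CM field is a non-unit»; Stub C's class-factor hypothesis ⟺ «the field factor at
the CM field is a unit».** `‖bernoulliOnePrim (bernoulliCharTwo ψ ε₀ ω)‖ ≤ p⁻¹ ↔ ‖bernoulliOnePrim ψ⁻¹‖ ≤ p⁻¹` on the binders of
`bernoulliOnePrim_bernoulliCharTwo_cmField_eq`. [cite: KrizLi2019, Thm. 1.20 (p. 8) and §8 (pp. 49–52)] -/
theorem norm_bernoulliCharTwo_cmField_le_inv_iff (hCM : W.HasCM) (hram : CMRamified W p) (h5 : 5 ≤ p)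
    (ω : DirichletCharacter ℚ_[p] p) (hω : IsTeichmullerCharacter ω)
    {f : ℕ} [NeZero f] (ψ : DirichletCharacter ℚ_[p] f) (hψ : ψ.Odd)
    (hss : ∀ ℓ : ℕ, ℓ.Prime → ¬ (ℓ ∣ p * W.conductorNorm ℤ) →
      ‖((W.LFunction ℓ : ℤ) : ℚ_[p]) - (ψ (ℓ : ZMod f) + ψ⁻¹ (ℓ : ZMod f) * ω (ℓ : ZMod p))‖ < 1)
    {K₀ : Type} [Field K₀] [NumberField K₀] (hK₀ : IsImaginaryQuadratic K₀) (hd : NumberField.discr K₀ = -(p : ℤ))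
    (ε₀ : DirichletCharacter ℚ_[p] (NumberField.discr K₀).natAbs) (hε₀ : IsKroneckerCharacterOf K₀ ε₀) :
    ‖bernoulliOnePrim (bernoulliCharTwo ψ ε₀ ω)‖ ≤ (p : ℝ)⁻¹ ↔ ‖bernoulliOnePrim ψ⁻¹‖ ≤ (p : ℝ)⁻¹ := by
  rw [bernoulliOnePrim_bernoulliCharTwo_cmField_eq W hCM hram h5 ω hω ψ hψ hss hK₀ hd ε₀ hε₀]

/-- **In the Cohen–Eisenstein currency of w8 g3/g4: the field factor at the CM field is a unit iff `‖B_{p−k,χ}/(p−k)‖_p = 1`**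
(class data `(m, χ, ε, k)` as in `KummerDictionary.norm_bernoulliOnePrim_inv_le_inv_iff_of_hss`; in classical terms
`p ∤ H(p−k, |e|) = −B_{p−k,χ_e}/(p−k)`). [cite: KrizLi2019, Thm. 1.20 (p. 8)] [cite: Washington1997, Thm. 5.11 and Cor. 5.13] -/
theorem norm_bernoulliCharTwo_cmField_le_inv_iff_classBernoulli (hCM : W.HasCM) (hram : CMRamified W p) (h5 : 5 ≤ p)
    {m : ℕ} [NeZero m] (χ : DirichletCharacter ℚ_[p] m) (ε : ℕ → ℤ) (k : ℕ) (ω : DirichletCharacter ℚ_[p] p)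
    (hχ : χ.IsPrimitive) (hχq : χ.IsQuadratic) (hmp : m.Coprime p)
    (hε : ∀ ℓ : ℕ, ℓ.Prime → ℓ ≠ p → χ (ℓ : ZMod m) = (ε ℓ : ℚ_[p]))
    (hk2 : 2 ≤ k) (hkp : k ≤ p - 2) (hpar : χ (-1) * (-1) ^ k = -1)
    (htr : ∀ ℓ : ℕ, ℓ.Prime → ℓ ≠ p →
      ((W.LFunction ℓ : ℤ) : ZMod p) = (ε ℓ : ZMod p) * ((ℓ : ZMod p) ^ k + (ℓ : ZMod p) ^ (p - k)))
    (hgoodW : ∀ ℓ : ℕ, (hℓ : ℓ.Prime) → ℓ ≠ p → ¬ ℓ ∣ m → (haveI := Fact.mk hℓ; W.HasGoodReductionAtPrime ℓ))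
    (hω : IsTeichmullerCharacter ω) {f : ℕ} [NeZero f] (ψ : DirichletCharacter ℚ_[p] f) (hψ : ψ.Odd)
    (hss : ∀ ℓ : ℕ, ℓ.Prime → ¬ (ℓ ∣ p * W.conductorNorm ℤ) →
      ‖((W.LFunction ℓ : ℤ) : ℚ_[p]) - (ψ (ℓ : ZMod f) + ψ⁻¹ (ℓ : ZMod f) * ω (ℓ : ZMod p))‖ < 1)
    {K₀ : Type} [Field K₀] [NumberField K₀] (hK₀ : IsImaginaryQuadratic K₀) (hd : NumberField.discr K₀ = -(p : ℤ))
    (ε₀ : DirichletCharacter ℚ_[p] (NumberField.discr K₀).natAbs) (hε₀ : IsKroneckerCharacterOf K₀ ε₀) :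
    ‖bernoulliOnePrim (bernoulliCharTwo ψ ε₀ ω)‖ ≤ (p : ℝ)⁻¹ ↔
      ‖((p - k : ℕ) : ℚ_[p])⁻¹ * generalizedBernoulli (p - k) χ‖ ≤ (p : ℝ)⁻¹ := by
  rw [norm_bernoulliCharTwo_cmField_le_inv_iff W hCM hram h5 ω hω ψ hψ hss hK₀ hd ε₀ hε₀]
  exact norm_bernoulliOnePrim_inv_le_inv_iff_of_hss W χ ε k ω ψ h5 hχ hχq hmp hε hk2 hkp hpar htr hgoodW hω hψ hss

/-- **The CM field is never a Heegner field of the class**: `p ∣ N_W` (additive reduction at the CM-ramified prime,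
`X12.addv_of_hasCM_of_cmRamified`) and `p ∣ d_{K₀}` does not split in `K₀` (Dedekind: ramified). So Stub C's witness `K''` is
never `K₀`, although by `norm_bernoulliCharTwo_cmField_le_inv_iff` `K₀` passes the field-factor clause on every member with unit
class factor — the «seed» of the analytic supply problem. [cite: SilvermanAEC2009, Cor. VII.7.2] [cite: Marcus2018, Ch. 3 Thm. 34 (p. 92)] [cite: GrossLMS1991, §1 (p. 235)] -/
theorem not_satisfiesHeegnerHypothesis_cmField [W.IsGloballyMinimal] (hCM : W.HasCM) (hram : CMRamified W p) (h5 : 5 ≤ p)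
    {K₀ : Type} [Field K₀] [NumberField K₀] (hK₀ : IsImaginaryQuadratic K₀) (hd : NumberField.discr K₀ = -(p : ℤ)) :
    ¬ SatisfiesHeegnerHypothesis (W.conductorNorm ℤ) K₀ := by
  intro hH
  have hpN : p ∣ W.conductorNorm ℤ :=
    (W.dvd_conductorNorm_iff_not_hasGoodReductionAtPrime p).mpr (X12.addv_of_hasCM_of_cmRamified W p hCM (by omega) hram).1
  have hdisc : (p : ℤ) ∣ NumberField.discr K₀ := by rw [hd, dvd_neg]
  exact Hsieh2014.ncard_primesOver_ne_two_of_dvd_discr K₀ hK₀.1 hp.out hdisc (hH p hp.out hpN)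

end Binders

end Summit.BirchSwinnertonDyer.BirchSwinnertonDyer.Theorems.PrintCFram.HeegnerFieldSupply

end
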